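import Literature.NumberTheory.LFunctions.DedekindCloseZeroHypothesis
import Literature.NumberTheory.LFunctions.ConreyIwaniec2002ThmOneOneWeak
import HarnessLib

/-!
# The `ψ = 1` Dedekind close-zero door (card K6-9) re-threaded on the weak Theorem 1.1:
# `H_K(A, α) ⇒ L(1,χ) ≥ ¼ (log q)^{−(4A+19)}` for odd `q`, from the typed Proposition 9.1 alone

The tree's `lOne_lowerBound_of_dedekindCloseZero` (`DedekindCloseZeroHypothesis.lean`) proves the
budget arithmetic `H_K(A, α) ∧ Thm 1.1 ⇒ L(1,χ) ≥ ¼ (log q)^{−(4A+18)}` modulo the named fact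
`conreyIwaniec2002_theorem11` (Conrey–Iwaniec 2002, Theorem 1.1 AS PRINTED, exponent `2A+6`). The
printed route to that exponent uses the unlocated claim of (9.11) (findings register
F-S3/CI-(9.11); `ConreyIwaniec2002PrincipalEstimate.lean`); the located inputs give Theorem 1.1
with `2A+7` for odd `q` (`conreyIwaniec2002_theorem11_weak`, file
`ConreyIwaniec2002ThmOneOneWeak.lean`, derived there from the typed Proposition 9.1). This file is
the same door read on the weak theorem — the arithmetic is unchanged, the exponent moves by one:

* `lOne_lowerBound_of_dedekindCloseZero_weak` — `H_K(A, α)` and the weak Theorem 1.1 give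
  `L(1,χ) ≥ ¼ (log q)^{−(4A+19)}` for all large ODD `q` (tree proof verbatim, `2A+6 ↦ 2A+7`);
* `lOne_lowerBound_of_dedekindCloseZero_of_proposition91` — hence from `H_K(A, α)` and the typed
  Proposition 9.1 ALONE (no (9.11)-claim);
* `dedekind_budget_weak_iff` — the Theorem-1 budget now reads `4A+19 < 2022 ⇔ A < 2003/4`
  (`= 500.75`; was `A < 501`).

The hypothesis `DedekindCloseZeroHypothesis A α` (a PREDICATE, never asserted) and the audited door
are imported, not restated. NOT RH-BEARING; nothing about actual zeros is asserted; no Landau–Siegel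
statement is proved by this file.

## References
* [ConreyIwaniec2002] J. B. Conrey, H. Iwaniec, Acta Arith. 103 (2002) 259–312 = arXiv:math/0111012,
  Theorem 1.1 (1.19)–(1.21); p. 3 L1–L6 (the `ζ_K` remark).
-/

noncomputable section

open scoped NumberField
open Complex

namespace Literature.NumberTheory.LFunctions

open ConreyIwaniec2002 NumberField

/-- **The door at `ψ = 1` on the weak Theorem 1.1 (budget arithmetic, proved modulo
`conreyIwaniec2002_theorem11_weak`):** `H_K(A, α)` and Theorem 1.1 with exponent `2A+7` give
`L(1,χ) ≥ ¼ (log q)^{−(4A+19)}` for all large odd quadratic conductors `q` (`χ = (−q/·)` odd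
primitive quadratic) — `(log T)^{−2} ≥ ¼ (log q)^{−(2A+12)}` on the window `log T ≤ 2(log q)^{A+6}`,
times `(log q)^{−(2A+7)}`. Tree `lOne_lowerBound_of_dedekindCloseZero` verbatim with `6 ↦ 7`,
`18 ↦ 19`, plus §7's `Odd q`. [cite: ConreyIwaniec2002, Theorem 1.1 (1.21)] -/
theorem lOne_lowerBound_of_dedekindCloseZero_weak {A α : ℝ} (hA : 0 ≤ A) (hα : 0 < α)
    (hα1 : α ≤ 1) (hCI : conreyIwaniec2002_theorem11_weak) (h : DedekindCloseZeroHypothesis A α) :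
    ∃ q₀ : ℕ, ∀ (q : ℕ) [NeZero q], q₀ ≤ q → 4 < q → Odd q →
      ∀ χ : DirichletCharacter ℂ q, χ.IsPrimitive → χ.IsQuadratic → χ.Odd →
        ∀ (K : Type) [Field K] [NumberField K],
          Module.finrank ℚ K = 2 → NumberField.discr K = -(q : ℤ) →
            (1 / 4) * Real.log q ^ (-(4 * A + 19)) ≤ ‖χ.LFunction 1‖ := by
  obtain ⟨c, hc, hci⟩ := hCI
  obtain ⟨q₀, hq₀⟩ := h c hc
  refine ⟨q₀, fun q _ hq hq4 hoddq χ hprim hquad hodd K _ _ h2 hdisc => ?_⟩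
  obtain ⟨T, hT2, hlo, hhi, hcount⟩ := hq₀ q hq hq4 χ hprim hquad hodd K h2 hdisc
  have hq1 : (1 : ℝ) < q := by exact_mod_cast (show 1 < q by omega)
  have hlq : 0 < Real.log q := Real.log_pos hq1
  have hpowpos : 0 < Real.log q ^ (A + 6) := Real.rpow_pos_of_pos hlq _
  have hlT : 0 < Real.log T := lt_of_lt_of_le hpowpos hlo
  -- the weak Theorem 1.1 at `ψ = 1`
  have key := hci A hA q hq4 hoddq χ hprim hquad hodd K h2 hdisc 1 T α hT2 hα hα1 hlo hcount
  -- `(log T)^{-2} ≥ (2 (log q)^{A+6})^{-2} = ¼ (log q)^{-(2A+12)}`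
  have h1 : (1 / 4) * Real.log q ^ (-(2 * A + 12)) ≤ Real.log T ^ (-(2 : ℝ)) := by
    have e1 : Real.log T ^ (-(2 : ℝ)) = (Real.log T ^ (2 : ℝ))⁻¹ := Real.rpow_neg hlT.le 2
    have e2 : Real.log q ^ (-(2 * A + 12)) = (Real.log q ^ (2 * A + 12))⁻¹ :=
      Real.rpow_neg hlq.le _
    rw [e1, e2]
    have hsq : Real.log T ^ (2 : ℝ) ≤ 4 * Real.log q ^ (2 * A + 12) := by
      have hle : Real.log T ^ (2 : ℝ) ≤ (2 * Real.log q ^ (A + 6)) ^ (2 : ℝ) :=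
        Real.rpow_le_rpow hlT.le hhi (by norm_num)
      have heq : (2 * Real.log q ^ (A + 6)) ^ (2 : ℝ) = 4 * Real.log q ^ (2 * A + 12) := by
        rw [Real.mul_rpow (by norm_num) hpowpos.le, ← Real.rpow_mul hlq.le]
        have : (A + 6) * 2 = 2 * A + 12 := by ring
        rw [this]; norm_num
      rw [heq] at hle; exact hle
    have hpos2 : 0 < Real.log T ^ (2 : ℝ) := Real.rpow_pos_of_pos hlT _
    have hpos4 : 0 < 4 * Real.log q ^ (2 * A + 12) := by positivity
    calc (1 / 4) * (Real.log q ^ (2 * A + 12))⁻¹ = (4 * Real.log q ^ (2 * A + 12))⁻¹ := by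
          rw [mul_inv]; norm_num
      _ ≤ (Real.log T ^ (2 : ℝ))⁻¹ := by
          exact inv_anti₀ hpos2 hsq
  -- assemble: `¼ (log q)^{-(4A+19)} = ¼ (log q)^{-(2A+12)} · (log q)^{-(2A+7)} ≤ (log T)^{-2} (log q)^{-(2A+7)}`
  have hsplit : Real.log q ^ (-(4 * A + 19)) =
      Real.log q ^ (-(2 * A + 12)) * Real.log q ^ (-(2 * A + 7)) := by
    rw [← Real.rpow_add hlq]; congr 1; ring
  have hpos7 : 0 ≤ Real.log q ^ (-(2 * A + 7)) := (Real.rpow_pos_of_pos hlq _).le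
  calc (1 / 4) * Real.log q ^ (-(4 * A + 19))
        = ((1 / 4) * Real.log q ^ (-(2 * A + 12))) * Real.log q ^ (-(2 * A + 7)) := by
          rw [hsplit]; ring
    _ ≤ Real.log T ^ (-(2 : ℝ)) * Real.log q ^ (-(2 * A + 7)) :=
          mul_le_mul_of_nonneg_right h1 hpos7
    _ ≤ ‖χ.LFunction 1‖ := key

/-- **The door from `H_K(A, α)` and the typed Proposition 9.1 ALONE** (no (9.11)-claim, no
Siegel-type input): `L(1,χ) ≥ ¼ (log q)^{−(4A+19)}` for all large odd `q`.
[cite: ConreyIwaniec2002, Theorem 1.1 (1.21)] -/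
theorem lOne_lowerBound_of_dedekindCloseZero_of_proposition91 {A α : ℝ} (hA : 0 ≤ A) (hα : 0 < α)
    (hα1 : α ≤ 1) (h91 : conreyIwaniec2002_proposition91) (h : DedekindCloseZeroHypothesis A α) :
    ∃ q₀ : ℕ, ∀ (q : ℕ) [NeZero q], q₀ ≤ q → 4 < q → Odd q →
      ∀ χ : DirichletCharacter ℂ q, χ.IsPrimitive → χ.IsQuadratic → χ.Odd →
        ∀ (K : Type) [Field K] [NumberField K],
          Module.finrank ℚ K = 2 → NumberField.discr K = -(q : ℤ) →
            (1 / 4) * Real.log q ^ (-(4 * A + 19)) ≤ ‖χ.LFunction 1‖ :=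
  lOne_lowerBound_of_dedekindCloseZero_weak hA hα hα1
    (conreyIwaniec2002_theorem11_weak_of_proposition91 h91) h

/-- The Theorem-1 budget read on `H_K` through the weak door: the effective exponent `4A + 19` is
`< 2022` iff `A < 2003/4 = 500.75` (was `A < 501` at `4A + 18`, `dedekind_budget_iff`).
[cite: ConreyIwaniec2002, Theorem 1.1 (1.21)] -/
theorem dedekind_budget_weak_iff (A : ℝ) : 4 * A + 19 < 2022 ↔ A < 2003 / 4 := by
  constructor <;> intro h <;> linarith

end Literature.NumberTheory.LFunctions

end
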